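import Summits.HodgeConjecture.HodgeConjecture.Theorems.CYFormCasimirCYFormCarrierEightGalois
import Summits.HodgeConjecture.HodgeConjecture.Theorems.CYFormCasimirCYFormCarrierEightScalar
import Summits.HodgeConjecture.HodgeConjecture.Theorems.CYFormCasimirCYFormCarrierEightLagrangianFrame
import Literature.NumberTheory.EllipticCurves.LatticeInclusionRigidityProofs
import HarnessLib

/-!
# Crux X1 `CYFormCarrierEight` (route `CYFormCasimir`, stmt-HodgeConjecture-23493), helper file 21:
# the NORM CONDITION — on a hyperbolic eightfold `s₋ s₊ = λ₀` with `λ₀ = P² + d Q²`, `P, Q ∈ ℚ`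

research route conditional on HC_CM; not a corollary. Nothing here proves HC, HC_CM, the rung H2, X1 or
`stub_cyform_exists`; step S4 of `Cruxes/CYFormCarrierEight/STUB-PLAN-stub_cyform_exists.md` — Friedman–Laza's condition
"`⋆⋆ = (-1)ⁿ disc ∈ Nm(K^×)`" (Lemma 36 / Prop. 37), obtained here WITHOUT the discriminant, from the Lagrangian frame
(helper file 20): with `u₊ = w_{I₀}` (`⋀⁴U₊`) and `u₋ = δ · w^*_{I₀ᶜ}` (`⋀⁴U₋`), the frame formulas of helper file 15 give
`s₊ u₊ = c · u₋`, `s₋ u₋ = c' · u₊`, so `λ₀ = c c'`; the Galois behaviour (`σ_*` fixes / exchanges `u₊, u₋` and commutes /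
intertwines `s₊, s₋`, helper files 18, 20) gives `σ(c) = c, σ(c') = c'` for `σ(i√d) = i√d` and `σ(c) = c', σ(c') = c` for
`σ(i√d) = -i√d`; hence `c + c'` and `(c - c')·i√d` are fixed by `Aut(ℂ)`, i.e. RATIONAL (the tree's
`exists_ratCast_eq_of_forall_ringEquiv`), and `λ₀ = c c' = ((c+c')/2)² + d·((c-c')i√d/(2d))²`.

* `exists_rat_sq_add_mul_sq_eq` — **`λ₀ = P² + d·Q²` with `P, Q ∈ ℚ`** for the duality operators of a Hodge-general
  HYPERBOLIC `ℚ(√-d)`-Weil eightfold.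

References: FriedmanLaza2013 (§3.5 Lemma 36, Prop. 37), vanGeemen1994HodgeAV (Lemma 5.2, 5.4), Deligne1982HodgeCycles (I §3).
-/

-- `Summit.HodgeConjecture.HodgeConjecture.…` is the tree's mandated summit/problem namespace (single-problem summit).
set_option linter.dupNamespace false
noncomputable section

open CategoryTheory
open Literature.AlgebraicTopology.SingularHomology
open Literature.AlgebraicGeometry.Motives
open Literature.AlgebraicGeometry.HodgeTheory
open Literature.AlgebraicGeometry.VanGeemen1994

namespace Summit.HodgeConjecture.HodgeConjecture.Theorems.CYFormCarrier

/-! ## The norm condition (a complex number fixed by `Aut(ℂ)` is rational: the tree's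
`Literature.NumberTheory.EllipticCurves.exists_ratCast_eq_of_forall_ringEquiv`) -/

section Norm

variable {A : AbelianVariety ℂ} {d : ℕ} {φ : A ⟶ A}
variable (hd : 0 < d) (hA : A.dim = 2 * 4) (hφ : φ ≫ φ = -(d • 𝟙 A))
  (e : ProjectiveEmbedding A.X) {a : complexBetti (projectiveSpace e.n ℂ) 2} (ha : IsRationalClass a) (ha0 : a ≠ 0)

include hd hA hφ e ha ha0 in
/-- **The norm condition.** On a Hodge-general (`Hg = SU_H`) HYPERBOLIC `ℚ(√-d)`-Weil eightfold, for the duality operators `s₊`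
(datum `v ∈ ⋀⁸W^*`), `s₋` (datum `v' ∈ ⋀⁸W`) attached to the components of a rational Weil class `v' + v`, the scalar `λ₀`
with `s₋ s₊ = λ₀` on `⋀⁴W` is of the form `λ₀ = P² + d·Q²` with `P, Q ∈ ℚ` — a norm from `K = ℚ(√-d)`.
[cite: FriedmanLaza2013, §3.5 Lemma 36 and Prop. 37] [cite: vanGeemen1994HodgeAV, Lemma 5.2 and 5.4] -/
theorem exists_rat_sq_add_mul_sq_eq (hSU : HasHodgeGroupSU A φ 4 d (hK d φ e a))
    (hhyp : IsHyperbolicWeilType A φ 4 (hK d φ e a))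
    {v v' : complexBetti A.X (2 * 4)} (hv : v ∈ weilClassesMinus A φ 4 d) (hv' : v' ∈ weilClassesPlus A φ 4 d)
    (hw : IsRationalClass (v' + v))
    (S : complexBetti A.X (2 * 2) →ₗ[ℂ] complexBetti A.X (2 * 2))
    (hS1 : ∀ x ∈ weilClassesPlus A φ 2 d, S x ∈ weilClassesMinus A φ 2 d)
    (hS2 : ∀ x ∈ weilClassesPlus A φ 2 d, ∀ z ∈ weilClassesPlus A φ 2 d,
      topCoord (dim_eq_seven_add_one hA)
          (cupProduct (show 2 * 4 + 2 * 4 = 2 + 2 * 7 from rfl)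
            (cupProduct (show 2 * 2 + 2 * 2 = 2 * 4 from rfl) z (S x)) (cupPowTwo (hK d φ e a) 4)) =
        topCoord (dim_eq_seven_add_one hA)
          (cupProduct (show 2 * 4 + 2 * 4 = 2 + 2 * 7 from rfl)
            (cupProduct (show 2 * 2 + 2 * 2 = 2 * 4 from rfl) z x) v))
    (S' : complexBetti A.X (2 * 2) →ₗ[ℂ] complexBetti A.X (2 * 2))
    (hS'1 : ∀ y ∈ weilClassesMinus A φ 2 d, S' y ∈ weilClassesPlus A φ 2 d)
    (hS'2 : ∀ y ∈ weilClassesMinus A φ 2 d, ∀ z' ∈ weilClassesMinus A φ 2 d,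
      topCoord (dim_eq_seven_add_one hA)
          (cupProduct (show 2 * 4 + 2 * 4 = 2 + 2 * 7 from rfl)
            (cupProduct (show 2 * 2 + 2 * 2 = 2 * 4 from rfl) z' (S' y)) (cupPowTwo (hK d φ e a) 4)) =
        topCoord (dim_eq_seven_add_one hA)
          (cupProduct (show 2 * 4 + 2 * 4 = 2 + 2 * 7 from rfl)
            (cupProduct (show 2 * 2 + 2 * 2 = 2 * 4 from rfl) z' y) v'))
    {lam : ℂ} (hlam : ∀ x ∈ weilClassesPlus A φ 2 d, S' (S x) = lam • x) :
    ∃ P Q : ℚ, lam = (P : ℂ) ^ 2 + (d : ℂ) * (Q : ℂ) ^ 2 := by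
  classical
  have hqk : 2 * 2 + 2 * 2 = Fintype.card (Fin (2 * 4)) := by rw [Fintype.card_fin]
  set s : ℂ := Complex.I * (Real.sqrt d : ℂ) with hs
  have hs2 : s ^ 2 = -(d : ℂ) := I_mul_sqrt_sq d
  have hs0 : s ≠ 0 := I_mul_sqrt_ne_zero hd
  have hd0 : (d : ℂ) ≠ 0 := Nat.cast_ne_zero.2 hd.ne'
  -- the Lagrangian frame
  obtain ⟨w, uM, δ, hδ0, huM, hfix, hswap⟩ := exists_lagrangian_frame hd hA hφ e ha ha0 hhyp hqk
  set b := weilBasis (m := 2 * 4 - 1) (k := 2 * 4) (by omega) (by omega) hd hφ e ha ha0 w with hbdef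
  have hb : b = weilBasis (m := 2 * 4 - 1) (k := 2 * 4) (by omega) (by omega) hd hφ e ha ha0 w := rfl
  set I₀ : Set.powersetCard (Fin (2 * 4)) (2 * 2) := Set.powersetCard.ofCard card_map_castAddEmb_univ_four with hI₀
  set uP := monB b (2 * 2) (Set.powersetCard.map (2 * 2) (Fin.castAddEmb (2 * 4)) I₀) with huP
  set m₀ := monB b (2 * 2) (Set.powersetCard.map (2 * 2) (Fin.natAddEmb (2 * 4)) (Set.powersetCard.compl hqk I₀)) with hm₀
  change uM = δ • m₀ at huM
  have huPmem : uP ∈ weilClassesPlus A φ 2 d := monB_frame_castAdd_mem_weilClassesPlus hd hA hφ e ha ha0 w b hb I₀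
  have hm₀mem : m₀ ∈ weilClassesMinus A φ 2 d := monB_frame_natAdd_mem_weilClassesMinus hd hA hφ e ha ha0 w b hb _
  have huMmem : uM ∈ weilClassesMinus A φ 2 d := by rw [huM]; exact Submodule.smul_mem _ _ hm₀mem
  have huP0 : uP ≠ 0 := (monB b (2 * 2)).ne_zero _
  have huM0 : uM ≠ 0 := by rw [huM]; exact smul_ne_zero hδ0 ((monB b (2 * 2)).ne_zero _)
  -- the frame formulas: `s₊ uP = cP • m₀`, `s₋ m₀ = cM • uP`
  obtain ⟨cP, hcP⟩ : ∃ cP : ℂ, S uP = cP • m₀ := ⟨_, starPlus_apply_frame hd hA hφ e ha ha0 w b hb hSU hqk v S hS1 hS2 I₀⟩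
  have hcM0 := starMinus_apply_frame hd hA hφ e ha ha0 w b hb hSU hqk v' S' hS'1 hS'2 (Set.powersetCard.compl hqk I₀)
  rw [compl_compl_eq] at hcM0
  obtain ⟨cM, hcM⟩ : ∃ cM : ℂ, S' m₀ = cM • uP := ⟨_, hcM0⟩
  -- in terms of `uM = δ • m₀`: `s₊ uP = c • uM`, `s₋ uM = c' • uP`
  set c : ℂ := cP / δ with hc
  set c' : ℂ := δ * cM with hc'
  have hSuP : S uP = c • uM := by
    rw [hcP, huM, smul_smul, hc, div_mul_cancel₀ _ hδ0]
  have hSuM : S' uM = c' • uP := by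
    rw [huM, map_smul, hcM, smul_smul]
  -- `λ₀ = c c'`
  have hlam' : lam = c * c' := by
    have h1 := hlam uP huPmem
    rw [hSuP, map_smul, hSuM, smul_smul] at h1
    have h2 : (c * c' - lam) • uP = 0 := by rw [sub_smul, h1, sub_self]
    rw [smul_eq_zero] at h2
    rcases h2 with h2 | h2
    · exact (sub_eq_zero.1 h2).symm
    · exact absurd h2 huP0
  -- Galois behaviour of `c`, `c'`
  have hGal : ∀ σ : ℂ ≃+* ℂ, (σ s = s → σ c = c ∧ σ c' = c') ∧ (σ s = -s → σ c = c' ∧ σ c' = c) := by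
    intro σ
    constructor
    · intro hσ
      obtain ⟨hτv', hτv⟩ := coeffClass_weilComponents_of_fix hd σ hσ hv' hv hw
      obtain ⟨hτP, hτM⟩ := hfix σ hσ
      change coeffClass (R := ℂ) (S := ℂ) σ.toRingHom.toAddMonoidHom (2 * 2) uP = uP at hτP
      constructor
      · -- apply `σ_*` to `s₊ uP = c • uM`
        have h1 := starPlus_coeffClass_of_fix hd hA hφ e ha ha0 σ S v hS1 hS2 hSU hσ hτv huPmem
        rw [hτP, hSuP, coeffClass_ringHom_smul, hτM] at h1
        have h2 : (σ c - c) • uM = 0 := by rw [sub_smul, sub_eq_zero]; exact h1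
        rw [smul_eq_zero] at h2
        rcases h2 with h2 | h2
        · exact sub_eq_zero.1 h2
        · exact absurd h2 huM0
      · have h1 := starMinus_coeffClass_of_fix hd hA hφ e ha ha0 σ S' v' hS'1 hS'2 hSU hσ hτv' huMmem
        rw [hτM, hSuM, coeffClass_ringHom_smul, hτP] at h1
        have h2 : (σ c' - c') • uP = 0 := by rw [sub_smul, sub_eq_zero]; exact h1
        rw [smul_eq_zero] at h2
        rcases h2 with h2 | h2
        · exact sub_eq_zero.1 h2
        · exact absurd h2 huP0
    · intro hσ
      obtain ⟨hτv', hτv⟩ := coeffClass_weilComponents_of_swap hd σ hσ hv' hv hw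
      obtain ⟨hτP, hτM⟩ := hswap σ hσ
      change coeffClass (R := ℂ) (S := ℂ) σ.toRingHom.toAddMonoidHom (2 * 2) uP = uM at hτP
      change coeffClass (R := ℂ) (S := ℂ) σ.toRingHom.toAddMonoidHom (2 * 2) uM = uP at hτM
      constructor
      · -- `σ_*(s₊ uP) = s₋(σ_* uP) = s₋ uM = c' uP`, and `σ_*(c uM) = σ(c) uP`
        have h1 := starPlus_coeffClass_of_swap hd hA hφ e ha ha0 σ S S' v v' hS1 hS2 hS'1 hS'2 hSU hσ hτv huPmem
        rw [hτP, hSuM, hSuP, coeffClass_ringHom_smul, hτM] at h1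
        have h2 : (σ c - c') • uP = 0 := by rw [sub_smul, sub_eq_zero]; exact h1
        rw [smul_eq_zero] at h2
        rcases h2 with h2 | h2
        · exact sub_eq_zero.1 h2
        · exact absurd h2 huP0
      · have h1 := starMinus_coeffClass_of_swap hd hA hφ e ha ha0 σ S S' v v' hS1 hS2 hS'1 hS'2 hSU hσ hτv' huMmem
        rw [hτM, hSuP, hSuM, coeffClass_ringHom_smul, hτP] at h1
        have h2 : (σ c' - c) • uM = 0 := by rw [sub_smul, sub_eq_zero]; exact h1
        rw [smul_eq_zero] at h2
        rcases h2 with h2 | h2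
        · exact sub_eq_zero.1 h2
        · exact absurd h2 huM0
  -- `c + c'` and `(c - c') i√d` are rational
  have hfix1 : ∀ σ : ℂ ≃+* ℂ, σ (c + c') = c + c' := by
    intro σ
    rcases ringHom_I_mul_sqrt σ.toRingHom d with hσ | hσ
    · obtain ⟨h1, h2⟩ := (hGal σ).1 hσ; rw [map_add, h1, h2]
    · obtain ⟨h1, h2⟩ := (hGal σ).2 hσ; rw [map_add, h1, h2, add_comm]
  have hfix2 : ∀ σ : ℂ ≃+* ℂ, σ ((c - c') * s) = (c - c') * s := by
    intro σ
    rcases ringHom_I_mul_sqrt σ.toRingHom d with hσ | hσ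
    · obtain ⟨h1, h2⟩ := (hGal σ).1 hσ
      have hσ' : σ s = s := hσ
      rw [map_mul, map_sub, h1, h2, hσ']
    · obtain ⟨h1, h2⟩ := (hGal σ).2 hσ
      have hσ' : σ s = -s := hσ
      rw [map_mul, map_sub, h1, h2, hσ']
      ring
  obtain ⟨P', hP'⟩ := Literature.NumberTheory.EllipticCurves.exists_ratCast_eq_of_forall_ringEquiv hfix1
  obtain ⟨M', hM'⟩ := Literature.NumberTheory.EllipticCurves.exists_ratCast_eq_of_forall_ringEquiv hfix2
  -- the algebra: `4 c c' d = (c + c')² d + ((c - c') s)²`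
  have key : 4 * (c * c') * (d : ℂ) = (c + c') ^ 2 * (d : ℂ) + ((c - c') * s) ^ 2 := by
    linear_combination (-(c - c') ^ 2) * hs2
  rw [← hP', ← hM'] at key
  refine ⟨P' / 2, M' / (2 * d), ?_⟩
  rw [hlam']
  push_cast
  have e1 : ((P' : ℂ) / 2) ^ 2 + (d : ℂ) * ((M' : ℂ) / (2 * (d : ℂ))) ^ 2 = ((P' : ℂ) ^ 2 * (d : ℂ) + (M' : ℂ) ^ 2) / (4 * (d : ℂ)) := by
    field_simp
    ring
  rw [e1, eq_div_iff (mul_ne_zero (by norm_num : (4 : ℂ) ≠ 0) hd0), ← key]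
  ring

end Norm

end Summit.HodgeConjecture.HodgeConjecture.Theorems.CYFormCarrier

end
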